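import Literature.NumberTheory.EllipticCurves.TwoVariableSelmerDual
import Literature.NumberTheory.EllipticCurves.IwasawaAlgebraTwoVarGeneratorChange
import Literature.NumberTheory.EllipticCurves.IwasawaAlgebraSemilinearCharIdealProofs
import Literature.NumberTheory.EllipticCurves.IwasawaAlgebraLengthAwayComparisonProofs
import Literature.NumberTheory.EllipticCurves.ZpExtensionDecompositionOpenImageProofs
import Literature.NumberTheory.IwasawaTheory.IwasawaAlgebraTwoVarRegularProofs
import HarnessLib

/-!
# SplitsliceG2 v1.0.1 (g37; v1.0.1 g39 = v1.0 with critic V#26at n1 paid: the file-wide `linter.unusedVariables` /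
# `linter.unusedSectionVars` silencers removed — one `omit [NumberField K] in`, one declaration-scoped option on the
# phantom-parameter type synonym `Twist`; no statement or proof changed) — item G2 of the crux idea «splitslice» (`Ideas/splitslice.md`): the τ-TRANSPORT of
# `ch_{Λ₂}(X_Gr)` that feeds the second pencil of DOOR 5♭ (`QtameDoor5.lean` v1.2, `engine_door5_frames`)

Crux `TwoVariableEulerSystemDivisibility` (stmt-BirchSwinnertonDyer-20728, route SignedBaseChange), stub F1 of the
registered line `Lines/ratlift.lean` v5.4 (unchanged; this is a COMPANION WORKFILE, not a skeleton; nothing here is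
registered). Ideator bsd-idea-14 g37, lens = complete. Everything below is kernel-checked commutative algebra /
bookkeeping over EXISTING tree declarations plus three `Prop`s (G2's typed sub-items); NO summit statement is proved,
BSD is not proved, the crux is not proved.

## 0 · What G2 has to deliver, in the currency door 5 actually consumes

`engine_door5ΘΘ Θ₁ Θ₂ dich 𝓟₁ 𝓟₂ X G hPT hT h₁ h₂` (QtameDoor5 v1.2 §E14.8) feeds `PatchingTarget`, which reads, for every
height-one prime `𝔓 ∌ p` of `Λ₂ = ℤ_p⟦T₂⟧⟦T₁⟧`, ONE divisibility `𝔓^{ℓ_𝔓(X)} ∣ (G)`; direction `i` supplies it at the primes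
`𝔓 = (F)` with `Θ_i F` visible, through `twisted_classical_dvd Θ_i 𝓟_i X G hT h_i` — i.e. through the LOCAL LENGTHS
`ℓ_𝔓(X)` AWAY FROM `p` and the ideal `(G)` up to `p`-power. Consequently direction 2 may be fed by ANY PROXY PAIR
`(X₂, G₂)` with `ℓ_𝔮(X₂) = ℓ_𝔮(X)` at every height-one `𝔮 ∌ p` and `G₂ ∣ p^e·G` (`patchInput_of_proxy`, §5 — the
ten-line edit «`engine_door5ΘΘ_proxy`» of the engine is recorded in §6 for QtameDoor5 v1.3; the file is at its size cap,
so it is not applied in this generation).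

«splitslice» takes `Θ₁ = φ_{A₁}` (split frame adapted to the `𝔭̄`-pencil, G4's `Λ(Γ_v̄)`-slices) and `Θ₂ = φ_{A₁ M_τ} =
Θ₁ ∘ φ_τ` (`frameSubst_mul`), `φ_τ = frameSubst ℤ_p M_τ`, and the proxy `(X₂, G₂) := (Twist φ_τ X, φ_τ G)`: then
`Twist Θ₂ X₂ = Twist Θ₁ X` and `Θ₂ G₂ = Θ₁ G` ON THE NOSE (`φ_τ² = 1`, `diagFrame_tau_mul_tau`), so the direction-2
hypothesis `h₂` IS the direction-1 hypothesis `h₁` (with `𝓟₂ := 𝓟₁`): ONE pencil of classical Euler-system fibre bounds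
(G4) is used twice. RIGHT multiplication is essential: door 5's transversality `(A₁A₂⁻¹)₀₁ ≠ 0` reads
`(A₁M_τA₁⁻¹)₀₁ = 2·a₀₀a₀₁/det A₁ ≠ 0` for `A₂ = A₁M_τ` (true for a split frame, whose first row has no zero entry;
`2 ∈ ℤ_pˣ`), whereas `A₂ = M_τA₁` would give `(A₁A₂⁻¹)₀₁ = (M_τ)₀₁ = 0`. What remains is to certify the proxy:
* (G2) `ℓ_𝔮(Twist φ_τ X) = ℓ_𝔮(X)` for all height-one `𝔮 ∌ p` ⟸ `(ch X)^{φ_τ} ≐ ch X` up to powers of `(p)`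
  (`lengthAt_twist_eq_of_idealPEq`, §5, from the tree's UFD dictionary
  `Module.lengthAt_eq_of_charIdeal_mul_span_pow_eq`) ⟸ CT₂ ∧ AFE₂ᵖ (`tauInvariant_of_conjTransport_of_algFE`, §4);
* (G3) `φ_τ G ∣ p^e · u · G` — the analytic functional equation, desk-checked in `G3-CHECK-g36.md`, typed in
  `SplitsliceG3.lean` (frame algebra) — not this file.

## 1 · The three involutions and the CONVENTION CAVEAT r1 (critic V#26ar) — settled in the kernel (§1 below)

Tree conventions (read, not assumed): `ZpExtension.IsTopGenerator κ γ := κ γ = ofAdd 1`;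
`IsTopGeneratorPair κ₁ κ₂ γ₁ γ₂ := κ₁.IsTopGenerator γ₁ ∧ γ₁ ∈ ker κ₂ ∧ γ₂ ∈ ker κ₁ ∧ κ₂.IsTopGenerator γ₂`
(Rubin1991/TwoVariableMainConjecture); `XGr₂`: `T₁ = X` acts as `γ₁ − 1`, `T₂ = C X` as `γ₂ − 1` (TwoVariableSelmerDual);
`frameMatrixOf κ₁ κ₂ γ₁ γ₂ σ`: column `j` = additive coordinates of `σ γ_j`; `frameSubst 𝒪 A : 1+T_j ↦ (1+T₁)^{A 0 j}(1+T₂)^{A 1 j}`,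
`φ_{AB} = φ_A ∘ φ_B` (IwasawaAlgebraTwoVarGeneratorChange). With `κ₁` CYCLOTOMIC (fixed by outer conjugation from `Γ_ℚ`,
`IsCyclotomic.apply_eq_of_absGaloisRestrict_eq_conj`) and `κ₂` ANTICYCLOTOMIC (inverted, `IsAnticyclotomic`):
  `M_c = diag(1, −1)` (`frameMatrixOf_conj`), `M_ι = diag(−1, −1)` (`frameMatrixOf_inv`), `M_τ = M_ι M_c = diag(−1, 1)`
  (`frameMatrixOf_tau`, `diagFrame_inv_mul_conj`) — EXACTLY the matrices of `G3-CHECK-g36.md` §2; no transpose.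
`τ = c∘ι` inverts the cyclotomic variable and fixes the anticyclotomic one; it exchanges the split pencils
(additive directions `(1,1)`, `(1,−1)`).

## 2 · Why τ and not plain complex conjugation c (new in g37; answers "is G2+G3 more than symmetry?")

With the proxy form of door 5 one might hope to feed direction 2 by the c-CONJUGATE INSTANCE of the one-pencil theorem
(swap `v ↔ v̄`): `X_Gr(v̄ ↔ v) = XGr₂ … v …` IS `Twist φ_c X` by CT₂, so no functional equation would be needed. It does
not type: the value frame `IsGreenbergLFunctionAnyRoot₂ ι v vbar …` (BSTW2024/GreenbergMainStatementOPEN l.191) hard-codes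
the infinity-type region `(−(m+1), n+1)` relative to Mathlib's `InfinitePlace.embedding` of `K`; complex conjugation sends
it to the DISJOINT region `(n+1, −(m+1))`, so the c-conjugate of an admissible `G` is not an admissible `G` for the swapped
primes (the swapped instance of the crux pairs region and Euler factors `typeTwoEulerFactor p α ξ vbar v` wrongly and is
satisfied by no interpolating function — flag `BSTW-924-conjugate-convention`). The region IS stable under `τ = c∘ι`
(`ξ ↦ (ξ^c)⁻¹`, `m ↔ n`), and τ maps `(X, G)` to a pair over the SAME data: that is why the transport costs exactly one
ALGEBRAIC functional equation (AFE₂ᵖ: Greenberg/Nekovář duality, `X_{∅v,0v̄}` versus `X_{0v,∅v̄}` up to `ι`) and one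
ANALYTIC one (G3), and needs no second Euler-system theorem. (A c-route would instead need the one-pencil theorem for a
conjugate value frame — a second theorem of the same size.)

## 3 · Contents

§1 frames of `c, ι, τ` (PROVED); §2 a verbatim local copy of door 5's `Twist` (Cruxes files cannot import each other) with
`Twist.charIdeal_eq`; §3 the relation `IdealPEq ϖ I J :↔ ∃ i i', I·(ϖ)^i = J·(ϖ)^{i'}` ("equal up to `ϖ`"); §4 the typed
G2 items `ConjTransport₂` (CT₂, exact), `AlgFunctionalEquation₂` (AFE₂ᵖ, up to `p`), `TauInvariant₂` (G2ᵖ) over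
`WeierstrassCurve.XGr₂` and the kernel reduction `TauInvariant₂ ⟸ CT₂ ∧ AFE₂ᵖ`; §5 USE: `lengthAt_twist_eq_of_idealPEq`
(G2ᵖ ⟹ the proxy `Twist φ_τ X` has the lengths of `X` away from `p`) and `patchInput_of_proxy`; §6 (docstring) the
v1.3 edit of `engine_door5ΘΘ`. Sizes: CT₂ [S/M] (functoriality of `unrSelmer₂` under `c̃ ∈ Γ_ℚ ∖ Γ_K`: the tree has
`conjSel₂` only for `γ ∈ Γ_K`); AFE₂ᵖ [M] (Nekovář, Selmer Complexes §8.9 / 9 duality over `ℤ_p⟦ℤ_p²⟧` with Greenberg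
local conditions `F_v⁺ = T, F_v̄⁺ = 0`, error terms pseudo-null: [corpus:paper:arxiv-2412.11147 p.8 Prop 1.4 = Nekovář
8.9.7.3/8.9.7.4, p.10–11 Thm 1.15]; the `p`-power slack makes the unramified-versus-strict discrepancy at `v̄` and any
`μ`-type defect harmless).

References: J. Nekovář, Selmer Complexes, Astérisque 310 (2006) §8.9, §9 (not held; cited through arXiv:2412.11147);
R. Greenberg, Iwasawa theory for p-adic representations (1989) Thm 2; K. Büyükboduk–A. Lei, arXiv:1707.00557 Def 3.8 (τ);
Bourbaki AC VII §4.4–4.5; NSW (5.3.5), (5.3.9)–(5.3.10).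
-/

set_option autoImplicit false
set_option linter.dupNamespace false

noncomputable section

open scoped Classical
open NumberField IsDedekindDomain Field
open Literature.NumberTheory.EllipticCurves Literature.NumberTheory.GaloisRepresentations
open Literature.NumberTheory.EllipticCurves.IwasawaAlgebra₂

namespace Summit.BirchSwinnertonDyer.BirchSwinnertonDyer.Cruxes.TwoVariableEulerSystemDivisibility.SplitsliceG2

variable {p : ℕ} [Fact p.Prime]

/-! ## §1 The frames of complex conjugation, inversion and τ = c∘ι (PROVED; convention caveat r1) -/

section Frames

/-- `diag(u,v)·diag(u',v') = diag(uu', vv')`. -/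
theorem diagFrame_mul (u v u' v' : ℤ_[p]ˣ) :
    (diagFrame u v * diagFrame u' v' : GL (Fin 2) ℤ_[p]) = diagFrame (u * u') (v * v') := by
  apply Units.ext
  simp

/-- `diag(u,v)⁻¹ = diag(u⁻¹, v⁻¹)`. -/
theorem diagFrame_inv (u v : ℤ_[p]ˣ) : ((diagFrame u v)⁻¹ : GL (Fin 2) ℤ_[p]) = diagFrame u⁻¹ v⁻¹ :=
  Units.ext rfl

/-- `diag(1,1) = 1`. -/
theorem diagFrame_one : (diagFrame 1 1 : GL (Fin 2) ℤ_[p]) = 1 := by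
  apply Units.ext
  simp [Matrix.one_fin_two]

/-- **`M_τ = M_ι · M_c`**: `diag(−1,−1)·diag(1,−1) = diag(−1,1)`. -/
theorem diagFrame_inv_mul_conj :
    (diagFrame (-1) (-1) * diagFrame 1 (-1) : GL (Fin 2) ℤ_[p]) = diagFrame (-1) 1 := by
  rw [diagFrame_mul]; simp

/-- **`M_τ² = 1`** (τ is an involution). -/
theorem diagFrame_tau_mul_tau : (diagFrame (-1) 1 * diagFrame (-1) 1 : GL (Fin 2) ℤ_[p]) = 1 := by
  rw [diagFrame_mul]; simpa using (diagFrame_one (p := p))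

/-- `M_τ⁻¹ = M_τ`. -/
theorem diagFrame_tau_inv : ((diagFrame (-1) 1)⁻¹ : GL (Fin 2) ℤ_[p]) = diagFrame (-1) 1 := by
  rw [diagFrame_inv]; simp

/-- `φ_τ ∘ φ_τ = id` on `Λ₂(𝒪)`. -/
theorem frameSubst_tau_tau (𝒪 : Type*) [CommRing 𝒪] [Algebra ℤ_[p] 𝒪] (F : PowerSeries (PowerSeries 𝒪)) :
    frameSubst 𝒪 (diagFrame (p := p) (-1) 1) (frameSubst 𝒪 (diagFrame (p := p) (-1) 1) F) = F := by
  rw [← frameSubst_mul, diagFrame_tau_mul_tau, frameSubst_one]; rfl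

variable {K : Type} [Field K] [NumberField K]
variable {κ₁ κ₂ : ZpExtension K p} {γ₁ γ₂ : absoluteGaloisGroup K}

/-- **`M_c = diag(1, −1)`**: the frame matrix of conjugation by a lift `c̃` of complex conjugation (any `σ` on `Γ_K`
whose restriction to `Γ_ℚ` is `g ↦ ρ g ρ⁻¹`, `ρ ∉ im(Γ_K → Γ_ℚ)`), for `κ₁` cyclotomic and `κ₂` anticyclotomic: `c̃`
FIXES the cyclotomic coordinate and INVERTS the anticyclotomic one. Convention caveat r1 settled: no transpose. -/
theorem frameMatrixOf_conj (hγ : ZpExtension.IsTopGeneratorPair κ₁ κ₂ γ₁ γ₂) (hκ₁ : κ₁.IsCyclotomic)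
    (hκ₂ : κ₂.IsAnticyclotomic) {ρ : absoluteGaloisGroup ℚ} (hρ : ρ ∉ Set.range (absGaloisRestrict ℚ K))
    (σ : absoluteGaloisGroup K → absoluteGaloisGroup K)
    (hσ : ∀ g, absGaloisRestrict ℚ K (σ g) = ρ * absGaloisRestrict ℚ K g * ρ⁻¹) :
    frameMatrixOf κ₁ κ₂ γ₁ γ₂ σ = ((diagFrame 1 (-1) : GL (Fin 2) ℤ_[p]) : Matrix (Fin 2) (Fin 2) ℤ_[p]) := by
  have hl : κ₁ γ₁ = Multiplicative.ofAdd 1 := hγ.left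
  have hr : κ₂ γ₂ = Multiplicative.ofAdd 1 := hγ.right
  have h00 : κ₁ (σ γ₁) = Multiplicative.ofAdd 1 :=
    (hκ₁.apply_eq_of_absGaloisRestrict_eq_conj (hσ γ₁)).trans hl
  have h01 : κ₁ (σ γ₂) = 1 := (hκ₁.apply_eq_of_absGaloisRestrict_eq_conj (hσ γ₂)).trans hγ.apply_right
  have h10 : κ₂ (σ γ₁) = 1 := by rw [hκ₂ γ₁ (σ γ₁) ρ hρ (hσ γ₁), hγ.apply_left, inv_one]
  have h11 : κ₂ (σ γ₂) = (Multiplicative.ofAdd (1 : ℤ_[p]))⁻¹ := by rw [hκ₂ γ₂ (σ γ₂) ρ hρ (hσ γ₂), hr]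
  ext i j
  fin_cases i <;> fin_cases j
  · simp [frameMatrixOf, h00]
  · simp [frameMatrixOf, h01]
  · simp [frameMatrixOf, h10]
  · simp [frameMatrixOf, h11]

omit [NumberField K] in
/-- **`M_ι = diag(−1, −1)`**: the frame matrix of inversion `g ↦ g⁻¹` (the Iwasawa involution `ι`). -/
theorem frameMatrixOf_inv (hγ : ZpExtension.IsTopGeneratorPair κ₁ κ₂ γ₁ γ₂) :
    frameMatrixOf κ₁ κ₂ γ₁ γ₂ (fun g ↦ g⁻¹) =
      ((diagFrame (-1) (-1) : GL (Fin 2) ℤ_[p]) : Matrix (Fin 2) (Fin 2) ℤ_[p]) := by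
  have hl : κ₁ γ₁ = Multiplicative.ofAdd 1 := hγ.left
  have hr : κ₂ γ₂ = Multiplicative.ofAdd 1 := hγ.right
  ext i j
  fin_cases i <;> fin_cases j
  · simp [frameMatrixOf, map_inv, hl]
  · simp [frameMatrixOf, map_inv, hγ.apply_right]
  · simp [frameMatrixOf, map_inv, hγ.apply_left]
  · simp [frameMatrixOf, map_inv, hr]

/-- **`M_τ = diag(−1, 1)`**: the frame matrix of `τ = c∘ι : g ↦ c̃ g⁻¹ c̃⁻¹` (any `σ` with restriction `g ↦ ρ g⁻¹ ρ⁻¹`):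
τ INVERTS the cyclotomic coordinate and FIXES the anticyclotomic one (G3-CHECK-g36 §2: Büyükboduk–Lei's τ,
de Shalit's `ε ↦ ε̌`). -/
theorem frameMatrixOf_tau (hγ : ZpExtension.IsTopGeneratorPair κ₁ κ₂ γ₁ γ₂) (hκ₁ : κ₁.IsCyclotomic)
    (hκ₂ : κ₂.IsAnticyclotomic) {ρ : absoluteGaloisGroup ℚ} (hρ : ρ ∉ Set.range (absGaloisRestrict ℚ K))
    (σ : absoluteGaloisGroup K → absoluteGaloisGroup K)
    (hσ : ∀ g, absGaloisRestrict ℚ K (σ g) = ρ * absGaloisRestrict ℚ K g⁻¹ * ρ⁻¹) :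
    frameMatrixOf κ₁ κ₂ γ₁ γ₂ σ = ((diagFrame (-1) 1 : GL (Fin 2) ℤ_[p]) : Matrix (Fin 2) (Fin 2) ℤ_[p]) := by
  have hl : κ₁ γ₁ = Multiplicative.ofAdd 1 := hγ.left
  have hr : κ₂ γ₂ = Multiplicative.ofAdd 1 := hγ.right
  have h00 : κ₁ (σ γ₁) = (Multiplicative.ofAdd (1 : ℤ_[p]))⁻¹ := by
    rw [hκ₁.apply_eq_of_absGaloisRestrict_eq_conj (hσ γ₁), map_inv, hl]
  have h01 : κ₁ (σ γ₂) = 1 := by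
    rw [hκ₁.apply_eq_of_absGaloisRestrict_eq_conj (hσ γ₂), map_inv, hγ.apply_right, inv_one]
  have h10 : κ₂ (σ γ₁) = 1 := by
    rw [hκ₂ γ₁⁻¹ (σ γ₁) ρ hρ (hσ γ₁), map_inv, hγ.apply_left, inv_one, inv_one]
  have h11 : κ₂ (σ γ₂) = Multiplicative.ofAdd 1 := by
    rw [hκ₂ γ₂⁻¹ (σ γ₂) ρ hρ (hσ γ₂), map_inv, inv_inv, hr]
  ext i j
  fin_cases i <;> fin_cases j
  · simp [frameMatrixOf, h00]
  · simp [frameMatrixOf, h01]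
  · simp [frameMatrixOf, h10]
  · simp [frameMatrixOf, h11]

end Frames

/-! ## §2 `Twist` (verbatim copy of QtameDoor5 v1.2 §E14.8 — Cruxes files are not importable) and its characteristic ideal -/

set_option linter.unusedVariables false in
/-- `X` with the action `r • x := Θ⁻¹(r) • x`; the identity `X → Twist Θ X` is `Θ`-semilinear (door 5, verbatim).
(`Θ` is a PHANTOM parameter of the type synonym by design — it only enters through the `Module` instance below —
so the unused-variable linter is silenced for this one declaration only; v1.0.1, critic V#26at n1.) -/
def Twist {R : Type*} [CommRing R] (Θ : R ≃+* R) (X : Type*) : Type _ := X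

namespace Twist

variable {R : Type*} [CommRing R] (Θ : R ≃+* R) (X : Type*) [AddCommGroup X] [Module R X]

instance : AddCommGroup (Twist Θ X) := inferInstanceAs (AddCommGroup X)

noncomputable instance : Module R (Twist Θ X) := Module.compHom X Θ.symm.toRingHom

/-- The identity `X ≃+ Twist Θ X`. -/
def of : X ≃+ Twist Θ X := AddEquiv.refl X

theorem smul_def (r : R) (x : Twist Θ X) : r • x = of Θ X (Θ.symm r • (of Θ X).symm x) := rfl

theorem of_smul (r : R) (x : X) : of Θ X (r • x) = Θ r • of Θ X x := by
  rw [smul_def, RingEquiv.symm_apply_apply]; rfl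

/-- The identity as a `Θ`-semilinear map. -/
def ofₛₗ : X →ₛₗ[(Θ : R →+* R)] Twist Θ X where
  toFun := of Θ X
  map_add' _ _ := rfl
  map_smul' r x := of_smul Θ X r x

instance [Module.Finite R X] : Module.Finite R (Twist Θ X) := by
  haveI : RingHomSurjective (Θ : R →+* R) := ⟨Θ.surjective⟩
  exact Module.Finite.of_surjective (ofₛₗ Θ X) (of Θ X).surjective

theorem isTorsion [IsDomain R] (h : Module.IsTorsion R X) : Module.IsTorsion R (Twist Θ X) := by
  intro x
  obtain ⟨⟨a, ha⟩, hax⟩ := @h ((of Θ X).symm x)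
  refine ⟨⟨Θ a, mem_nonZeroDivisors_of_ne_zero
    ((map_ne_zero_iff _ Θ.injective).mpr (nonZeroDivisors.ne_zero ha))⟩, ?_⟩
  change Θ a • x = 0
  have hax' : a • (of Θ X).symm x = 0 := hax
  rw [smul_def, RingEquiv.symm_apply_apply, hax', map_zero]

/-- `ℓ_𝔭(X) = ℓ_{Θ𝔭}(Twist Θ X)` (tree `Module.lengthAt_eq_of_semilinearEquiv`). -/
theorem lengthAt_eq (𝔭 : PrimeSpectrum R) :
    Module.lengthAt R X 𝔭 = Module.lengthAt R (Twist Θ X) (PrimeSpectrum.comapEquiv Θ 𝔭) :=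
  Module.lengthAt_eq_of_semilinearEquiv Θ (of Θ X) (of_smul Θ X) 𝔭

/-- `ℓ_𝔮(Twist Θ X) = ℓ_{Θ⁻¹𝔮}(X)`. -/
theorem lengthAt_eq' (𝔮 : PrimeSpectrum R) :
    Module.lengthAt R (Twist Θ X) 𝔮 = Module.lengthAt R X ((PrimeSpectrum.comapEquiv Θ).symm 𝔮) := by
  rw [lengthAt_eq Θ X ((PrimeSpectrum.comapEquiv Θ).symm 𝔮), OrderIso.apply_symm_apply]

/-- **`ch(Twist Θ X) = Θ(ch X)`** (tree `Module.charIdeal_eq_map_of_semilinearEquiv`; Greenberg LNM 1716 §1 "Char(M^ι) = ι Char M"). -/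
theorem charIdeal_eq : Module.charIdeal R (Twist Θ X) = (Module.charIdeal R X).map (Θ : R →+* R) :=
  Module.charIdeal_eq_map_of_semilinearEquiv Θ (of Θ X) (of_smul Θ X)

end Twist

/-! ## §3 Ideals equal up to a prime element: `I ≐_ϖ J` -/

section PEq

variable {R : Type*} [CommRing R]

/-- `I ≐_ϖ J`: `I·(ϖ)^i = J·(ϖ)^{i'}` for some `i, i'` — over `Λ₂` with `ϖ = p`, "equal after `⊗ ℚ`" (the currency of the
tree's `Module.exists_charIdeal_mul_span_pow_eq_iff_lengthAt_eq`). -/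
def IdealPEq (ϖ : R) (I J : Ideal R) : Prop :=
  ∃ i i' : ℕ, I * Ideal.span {ϖ} ^ i = J * Ideal.span {ϖ} ^ i'

namespace IdealPEq

variable {ϖ : R} {I J L : Ideal R}

theorem refl (ϖ : R) (I : Ideal R) : IdealPEq ϖ I I := ⟨0, 0, rfl⟩

theorem of_eq (ϖ : R) (h : I = J) : IdealPEq ϖ I J := ⟨0, 0, by rw [h]⟩

theorem symm (h : IdealPEq ϖ I J) : IdealPEq ϖ J I := by
  obtain ⟨i, i', h⟩ := h
  exact ⟨i', i, h.symm⟩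

theorem trans (h₁ : IdealPEq ϖ I J) (h₂ : IdealPEq ϖ J L) : IdealPEq ϖ I L := by
  obtain ⟨i, i', h₁⟩ := h₁
  obtain ⟨j, j', h₂⟩ := h₂
  refine ⟨i + j, i' + j', ?_⟩
  rw [pow_add, ← mul_assoc, h₁, mul_assoc, ← pow_add, add_comm i' j, pow_add, ← mul_assoc, h₂, mul_assoc,
    ← pow_add, add_comm j' i']

/-- Transport along a ring map fixing `ϖ`. -/
theorem map {S : Type*} [CommRing S] (f : R →+* S) {ϖ' : S} (hf : f ϖ = ϖ') (h : IdealPEq ϖ I J) :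
    IdealPEq ϖ' (I.map f) (J.map f) := by
  obtain ⟨i, i', h⟩ := h
  refine ⟨i, i', ?_⟩
  have := congrArg (Ideal.map f) h
  simpa only [Ideal.map_mul, Ideal.map_pow, Ideal.map_span, Set.image_singleton, hf] using this

end IdealPEq

end PEq

/-! ## §4 The typed G2 items over `X_Gr(E/K̃_∞)` and the reduction `TauInvariant₂ ⟸ ConjTransport₂ ∧ AlgFunctionalEquation₂` -/

section G2

variable (p)

/-- The frame `φ_A` as a ring endomorphism of `Λ₂ = ℤ_p⟦T₂⟧⟦T₁⟧` (coercion of the tree's `frameSubst ℤ_[p] A`). -/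
def frameHom (A : GL (Fin 2) ℤ_[p]) : IwasawaAlgebra₂ p →+* IwasawaAlgebra₂ p :=
  ((frameSubst ℤ_[p] A : PowerSeries (PowerSeries ℤ_[p]) ≃+* PowerSeries (PowerSeries ℤ_[p])) :
    PowerSeries (PowerSeries ℤ_[p]) →+* PowerSeries (PowerSeries ℤ_[p]))

theorem frameHom_apply (A : GL (Fin 2) ℤ_[p]) (F : IwasawaAlgebra₂ p) : frameHom p A F = frameSubst ℤ_[p] A F := rfl

/-- `φ_A ∘ φ_B = φ_{AB}`. -/
theorem frameHom_comp (A B : GL (Fin 2) ℤ_[p]) : (frameHom p A).comp (frameHom p B) = frameHom p (A * B) :=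
  RingHom.ext fun F ↦ (frameSubst_mul ℤ_[p] A B F).symm

/-- A frame fixes `p`. -/
theorem frameHom_natCast (A : GL (Fin 2) ℤ_[p]) : frameHom p A (p : IwasawaAlgebra₂ p) = p := map_natCast _ p

variable {K : Type} [Field K] [NumberField K] (W : WeierstrassCurve K)
variable (κ₁ κ₂ : ZpExtension K p) (v vbar : HeightOneSpectrum (𝓞 K)) (γ₁ γ₂ : absoluteGaloisGroup K)
  [Fact (ZpExtension.IsTopGeneratorPair κ₁ κ₂ γ₁ γ₂)]

/-- **CT₂ — conjugation transport** [S/M]: a lift `c̃ ∈ Γ_ℚ ∖ Γ_K` of complex conjugation carries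
`H¹_{nr,v̄}(K̃_∞, E[p^∞])` onto `H¹_{nr,v}(K̃_∞, E[p^∞])` (`E/ℚ`, so `c̃` acts on the coefficients; `K̃_∞/ℚ` is Galois),
twisting the `Γ_K`-action by `γ ↦ c̃γc̃⁻¹`; dually `X_Gr(v ↔ v̄) ≅ X_Gr` along `φ_c = φ_{diag(1,−1)}` (`frameMatrixOf_conj`).
The tree has `conjSel₂` for `γ ∈ Γ_K` only; the outer action is this item. -/
def ConjTransport₂ : Prop :=
  ∃ e : W.XGr₂ p κ₁ κ₂ vbar γ₁ γ₂ ≃+ W.XGr₂ p κ₁ κ₂ v γ₁ γ₂,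
    ∀ (r : IwasawaAlgebra₂ p) (x : W.XGr₂ p κ₁ κ₂ vbar γ₁ γ₂),
      e (r • x) = frameSubst ℤ_[p] (diagFrame (p := p) 1 (-1)) r • e x

/-- **AFE₂ᵖ — the algebraic functional equation up to `p`** [M]: `ch X_{∅v, nr v̄} ≐_p ι( ch X_{∅v̄, nr v} )`,
`ι = φ_{diag(−1,−1)}` (`frameMatrixOf_inv`) — Greenberg 1989 Thm 2 / Nekovář Selmer Complexes §8.9–9 duality over
`Λ = ℤ_p⟦ℤ_p²⟧` for `T = T_pE ≅ T^*(1)` with the Greenberg local conditions `(F_v⁺, F_v̄⁺) = (T, 0)`, whose orthogonal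
is `(0, T)`; error terms at `v ∤ p` pseudo-null [corpus:paper:arxiv-2412.11147 p.8 Prop 1.4, p.10–11 Thm 1.15]; the
strict/unramified discrepancy at `v̄` and any `μ`-part are absorbed by `≐_p`. Hypotheses of the printed theorem
(`X` torsion — one side suffices by CT₂ —, `E(K̃_∞)[p] = 0` under `Surj`) are the route's. -/
def AlgFunctionalEquation₂ : Prop :=
  IdealPEq (p : IwasawaAlgebra₂ p) (WeierstrassCurve.XGr₂.charIdeal W p κ₁ κ₂ vbar γ₁ γ₂)
    ((WeierstrassCurve.XGr₂.charIdeal W p κ₁ κ₂ v γ₁ γ₂).map (frameHom p (diagFrame (-1) (-1))))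

/-- **G2ᵖ — τ-invariance of `ch X_Gr` up to `p`**: `φ_τ(ch X) ≐_p ch X`, `τ = φ_{diag(−1,1)}` (`frameMatrixOf_tau`).
This is what certifies the direction-2 proxy `(Twist φ_τ X, φ_τ G)` of door 5♭ (§5). -/
def TauInvariant₂ : Prop :=
  IdealPEq (p : IwasawaAlgebra₂ p)
    ((WeierstrassCurve.XGr₂.charIdeal W p κ₁ κ₂ vbar γ₁ γ₂).map (frameHom p (diagFrame (-1) 1)))
    (WeierstrassCurve.XGr₂.charIdeal W p κ₁ κ₂ vbar γ₁ γ₂)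

variable {p W κ₁ κ₂ v vbar γ₁ γ₂}

/-- CT₂ ⟹ `ch X_Gr(v ↔ v̄) = φ_c(ch X_Gr)` EXACTLY (semilinear transport of characteristic ideals). -/
theorem charIdeal_swap_eq_map_of_conjTransport (hCT : ConjTransport₂ p W κ₁ κ₂ v vbar γ₁ γ₂) :
    WeierstrassCurve.XGr₂.charIdeal W p κ₁ κ₂ v γ₁ γ₂ =
      (WeierstrassCurve.XGr₂.charIdeal W p κ₁ κ₂ vbar γ₁ γ₂).map (frameHom p (diagFrame 1 (-1))) := by
  obtain ⟨e, he⟩ := hCT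
  exact Module.charIdeal_eq_map_of_semilinearEquiv (frameSubst ℤ_[p] (diagFrame (p := p) 1 (-1))) e he

/-- **KERNEL REDUCTION OF G2**: `CT₂ ∧ AFE₂ᵖ ⟹ G2ᵖ` — `ch X ≐_p ι(ch X^{c}) = ι(φ_c(ch X)) = φ_{M_ι M_c}(ch X) = φ_τ(ch X)`. -/
theorem tauInvariant_of_conjTransport_of_algFE (hCT : ConjTransport₂ p W κ₁ κ₂ v vbar γ₁ γ₂)
    (hFE : AlgFunctionalEquation₂ p W κ₁ κ₂ v vbar γ₁ γ₂) : TauInvariant₂ p W κ₁ κ₂ vbar γ₁ γ₂ := by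
  unfold TauInvariant₂
  unfold AlgFunctionalEquation₂ at hFE
  rw [charIdeal_swap_eq_map_of_conjTransport hCT, Ideal.map_map, frameHom_comp, diagFrame_inv_mul_conj] at hFE
  exact hFE.symm

/-- Conversely-shaped bookkeeping: G2ᵖ is symmetric under `τ ↦ τ⁻¹ = τ` — `ch X ≐_p φ_τ(ch X)` as well. -/
theorem tauInvariant₂_symm (h : TauInvariant₂ p W κ₁ κ₂ vbar γ₁ γ₂) :
    IdealPEq (p : IwasawaAlgebra₂ p) (WeierstrassCurve.XGr₂.charIdeal W p κ₁ κ₂ vbar γ₁ γ₂)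
      ((WeierstrassCurve.XGr₂.charIdeal W p κ₁ κ₂ vbar γ₁ γ₂).map (frameHom p (diagFrame (-1) 1))) :=
  h.symm

end G2

/-! ## §5 USE: G2ᵖ certifies the direction-2 proxy of door 5♭ -/

section Use

variable (p)

/-- `p` is a prime element of `Λ₂`. -/
theorem prime_natCast_iwasawaAlgebra₂ : Prime (p : IwasawaAlgebra₂ p) := by
  have h : (p : IwasawaAlgebra₂ p) = PowerSeries.C (PowerSeries.C (p : ℤ_[p])) := by
    rw [map_natCast, map_natCast]
  rw [h]
  exact prime_C_of_prime (prime_C_of_prime PadicInt.prime_p)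

variable {p}

/-- **G2ᵖ ⟹ the proxy has the right lengths.** For a finitely generated torsion `Λ₂`-module `X` and a ring automorphism
`Θ` of `Λ₂` FIXING `p` with `Θ(ch X) ≐_p ch X`: `ℓ_𝔮(Twist Θ X) = ℓ_𝔮(X)` at every height-one prime `𝔮 ∌ p` — the tree's
UFD dictionary `Module.lengthAt_eq_of_charIdeal_mul_span_pow_eq` (Λ₂ factorial: `uniqueFactorizationMonoid_iwasawaAlgebraTwoVar`)
applied to `ch(Twist Θ X) = Θ(ch X)`. With `Θ = φ_τ` and `X = X_Gr` the hypothesis is `TauInvariant₂`. -/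
theorem lengthAt_twist_eq_of_idealPEq (Θ : IwasawaAlgebra₂ p ≃+* IwasawaAlgebra₂ p) (X : Type)
    [AddCommGroup X] [Module (IwasawaAlgebra₂ p) X] [Module.Finite (IwasawaAlgebra₂ p) X]
    (hT : Module.IsTorsion (IwasawaAlgebra₂ p) X)
    (h : IdealPEq (p : IwasawaAlgebra₂ p) ((Module.charIdeal (IwasawaAlgebra₂ p) X).map (Θ : _ →+* _))
      (Module.charIdeal (IwasawaAlgebra₂ p) X))
    (𝔮 : PrimeSpectrum (IwasawaAlgebra₂ p)) (h1 : 𝔮.asIdeal.height = 1) (hp𝔮 : (p : IwasawaAlgebra₂ p) ∉ 𝔮.asIdeal) :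
    Module.lengthAt (IwasawaAlgebra₂ p) (Twist Θ X) 𝔮 = Module.lengthAt (IwasawaAlgebra₂ p) X 𝔮 := by
  haveI : UniqueFactorizationMonoid (IwasawaAlgebra₂ p) :=
    Literature.NumberTheory.IwasawaTheory.uniqueFactorizationMonoid_iwasawaAlgebraTwoVar p
  obtain ⟨i, i', hii⟩ := h
  rw [← Twist.charIdeal_eq Θ X] at hii
  exact Module.lengthAt_eq_of_charIdeal_mul_span_pow_eq (Twist.isTorsion Θ X hT) hT hii 𝔮 h1 hp𝔮

/-- The same in `Twist`-free form: `ℓ_{Θ⁻¹𝔮}(X) = ℓ_𝔮(X)` at every height-one `𝔮 ∌ p` («the local lengths of `X_Gr`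
away from `p` are τ-invariant» — the idea card's wording of G2). -/
theorem lengthAt_comap_eq_of_idealPEq (Θ : IwasawaAlgebra₂ p ≃+* IwasawaAlgebra₂ p) (X : Type)
    [AddCommGroup X] [Module (IwasawaAlgebra₂ p) X] [Module.Finite (IwasawaAlgebra₂ p) X]
    (hT : Module.IsTorsion (IwasawaAlgebra₂ p) X)
    (h : IdealPEq (p : IwasawaAlgebra₂ p) ((Module.charIdeal (IwasawaAlgebra₂ p) X).map (Θ : _ →+* _))
      (Module.charIdeal (IwasawaAlgebra₂ p) X))
    (𝔮 : PrimeSpectrum (IwasawaAlgebra₂ p)) (h1 : 𝔮.asIdeal.height = 1) (hp𝔮 : (p : IwasawaAlgebra₂ p) ∉ 𝔮.asIdeal) :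
    Module.lengthAt (IwasawaAlgebra₂ p) X ((PrimeSpectrum.comapEquiv Θ).symm 𝔮) =
      Module.lengthAt (IwasawaAlgebra₂ p) X 𝔮 := by
  rw [← Twist.lengthAt_eq' Θ X 𝔮]
  exact lengthAt_twist_eq_of_idealPEq Θ X hT h 𝔮 h1 hp𝔮

/-- For `X = X_Gr` and `Θ = φ_τ`: `TauInvariant₂` is literally the hypothesis of `lengthAt_twist_eq_of_idealPEq`. -/
theorem lengthAt_twist_tau_eq {K : Type} [Field K] [NumberField K] (W : WeierstrassCurve K)
    (κ₁ κ₂ : ZpExtension K p) (vbar : HeightOneSpectrum (𝓞 K)) (γ₁ γ₂ : absoluteGaloisGroup K)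
    [Fact (ZpExtension.IsTopGeneratorPair κ₁ κ₂ γ₁ γ₂)] [Module.Finite (IwasawaAlgebra₂ p) (W.XGr₂ p κ₁ κ₂ vbar γ₁ γ₂)]
    (hT : Module.IsTorsion (IwasawaAlgebra₂ p) (W.XGr₂ p κ₁ κ₂ vbar γ₁ γ₂))
    (hG2 : TauInvariant₂ p W κ₁ κ₂ vbar γ₁ γ₂)
    (𝔮 : PrimeSpectrum (IwasawaAlgebra₂ p)) (h1 : 𝔮.asIdeal.height = 1) (hp𝔮 : (p : IwasawaAlgebra₂ p) ∉ 𝔮.asIdeal) :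
    Module.lengthAt (IwasawaAlgebra₂ p)
        (Twist (frameSubst ℤ_[p] (diagFrame (p := p) (-1) 1) : IwasawaAlgebra₂ p ≃+* IwasawaAlgebra₂ p)
          (W.XGr₂ p κ₁ κ₂ vbar γ₁ γ₂)) 𝔮 =
      Module.lengthAt (IwasawaAlgebra₂ p) (W.XGr₂ p κ₁ κ₂ vbar γ₁ γ₂) 𝔮 := by
  apply lengthAt_twist_eq_of_idealPEq _ _ hT _ 𝔮 h1 hp𝔮
  unfold TauInvariant₂ frameHom WeierstrassCurve.XGr₂.charIdeal at hG2
  exact hG2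

/-- **The proxy step of door 5♭ (abstract over the engine's visibility predicate).** If `(X₂, G₂)` has the lengths of
`(X, ·)` away from `p` and `G₂ ∣ p^e · G`, then the direction-2 OUTPUT of `twisted_classical_dvd` for `(X₂, G₂)` —
`(F)^{ℓ_{(F)}(X₂)} ∣ (G₂)` at every prime element `F ∤ p` with `Vis F` — yields the same for `(X, G)`, which is what
`PatchingTarget` reads. Pure bookkeeping: `F^ℓ ∣ G₂ ∣ p^e G` and `F ∤ p` give `F^ℓ ∣ G` (`Prime.pow_dvd_of_dvd_mul_left`). -/
theorem patchInput_of_proxy {R : Type*} [CommRing R] [IsDomain R] [IsNoetherianRing R] (ϖ : R) (hϖ : Prime ϖ) (Vis : R → Prop)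
    (X X₂ : Type*) [AddCommGroup X] [Module R X] [AddCommGroup X₂] [Module R X₂] (G G₂ : R)
    (hlen : ∀ 𝔮 : PrimeSpectrum R, 𝔮.asIdeal.height = 1 → ϖ ∉ 𝔮.asIdeal →
      Module.lengthAt R X₂ 𝔮 = Module.lengthAt R X 𝔮)
    (hG : ∃ e : ℕ, G₂ ∣ ϖ ^ e * G)
    (h₂ : ∀ (F : R) (hF : Prime F), ¬ ϖ ∣ F → Vis F →
      Ideal.span {F} ^ (Module.lengthAt R X₂ ⟨Ideal.span {F}, (Ideal.span_singleton_prime hF.ne_zero).mpr hF⟩).toNat ∣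
        Ideal.span {G₂})
    (F : R) (hF : Prime F) (hϖF : ¬ ϖ ∣ F) (hv : Vis F) :
    Ideal.span {F} ^ (Module.lengthAt R X ⟨Ideal.span {F}, (Ideal.span_singleton_prime hF.ne_zero).mpr hF⟩).toNat ∣
      Ideal.span {G} := by
  obtain ⟨e, he⟩ := hG
  have hϖ𝔮 : ϖ ∉ Ideal.span {F} := fun hmem ↦
    hϖF ((hF.associated_of_dvd hϖ (Ideal.mem_span_singleton.mp hmem)).symm.dvd)
  have hFe : ¬ F ∣ ϖ ^ e := fun h ↦ hϖ𝔮 (Ideal.mem_span_singleton.mpr (hF.dvd_of_dvd_pow h))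
  have key := hlen ⟨Ideal.span {F}, (Ideal.span_singleton_prime hF.ne_zero).mpr hF⟩
    (Module.height_span_singleton_eq_one_of_prime hF) hϖ𝔮
  rw [← key]
  have hd := h₂ F hF hϖF hv
  rw [Ideal.span_singleton_pow] at hd ⊢
  have hd' := Ideal.span_singleton_le_span_singleton.mp (Ideal.le_of_dvd hd)
  obtain ⟨c, hc⟩ := hF.pow_dvd_of_dvd_mul_left _ hFe (hd'.trans he)
  exact ⟨Ideal.span {c}, by rw [Ideal.span_singleton_mul_span_singleton, ← hc]⟩

end Use

/-!
## §6 The v1.3 edit of the engine this prepares (NOT applied: `QtameDoor5.lean` is at its size cap)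

```
theorem engine_door5ΘΘ_proxy (Θ₁ Θ₂ : Λ₂ ≃+* Λ₂) (dich : …as engine_door5ΘΘ…) (𝓟₁ 𝓟₂ : EisensteinSystem p)
    (X X₂ : Type) […] (G G₂ : Λ₂) (hPT : PatchingTarget p X G) (hT : IsTorsion X) (hT₂ : IsTorsion X₂)
    (hlen : ∀ 𝔮, ht 𝔮 = 1 → ↑p ∉ 𝔮 → ℓ_𝔮 X₂ = ℓ_𝔮 X) (hG : ∃ e, G₂ ∣ p^e * G)
    (h₁ : ClassicalFibreBoundsPt p 𝓟₁ (Twist Θ₁ X) (Θ₁ G)) (h₂ : ClassicalFibreBoundsPt p 𝓟₂ (Twist Θ₂ X₂) (Θ₂ G₂)) :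
    ∃ a, (p^a·G) ⊆ ch X
```
proof = that of `engine_door5ΘΘ` with the second branch `twisted_classical_dvd Θ₂ 𝓟₂ X₂ G₂ hT₂ h₂ hF hv` followed by
`patchInput_of_proxy` (the branch already knows `¬ p ∣ F`). «splitslice» instance: `Θ₂ = Θ₁ ∘ φ_τ`, `X₂ = Twist φ_τ X`,
`G₂ = φ_τ G`, `hlen = lengthAt_twist_tau_eq … hG2`, `hG` = G3, and `h₂ = h₁` transported along the identity
`Twist Θ₂ (Twist φ_τ X) = Twist Θ₁ X` (`frameSubst_tau_tau`), `𝓟₂ = 𝓟₁`.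
-/

end Summit.BirchSwinnertonDyer.BirchSwinnertonDyer.Cruxes.TwoVariableEulerSystemDivisibility.SplitsliceG2

end
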